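import Literature.NumberTheory.GaloisRepresentations.IdeleBrauerReciprocity
import Literature.NumberTheory.GaloisRepresentations.GaloisCohomologyLayerInflationLimit
import Literature.NumberTheory.GaloisRepresentations.LocalCanonicalFundamentalClassInflation
import HarnessLib

/-!
# A class of `H²(Γ_F, μₙ)` is locally trivial at all but finitely many places (Milne *ADT* I Lemma 4.8 /
# Cassels–Fröhlich VII §7.3 Prop. 7.3 with §9.6: the local invariants of a Brauer class are almost all zero)

Topic `NumberTheory/GaloisRepresentations`; namespace `Literature.NumberTheory.GaloisRepresentations`.
Proof file: theorems only (no definition, no named fact, no instance, no notation, no `sorry`; D-0026).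
Number fields in `Type` (the universe of the tree's idèle cohomology).

THE STATEMENT.  Let `F` be a number field, `n ≥ 1`, `y ∈ H²(Γ_F, μₙ(F̄))` (`galoisCohomology (mu F n) 2`, continuous
cohomology of the absolute Galois group).  Then `loc_v y = 0` in `H²(Γ_{F_v}, μₙ(F̄)|)`
(`galoisCohomology.localization (mu F n) (Sum.inr v) 2`) for all but finitely many finite places `v` of `F`
(**`finite_setOf_localization_mu_two_ne_zero`**, `exists_finset_forall_localization_mu_two_eq_zero`), hence for all
but finitely many places (`finite_setOf_localization_mu_two_ne_zero_place`,
`exists_finset_place_forall_localization_mu_two_eq_zero`).  In print this is the finiteness of the support of the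
local invariants of a Brauer class (`Br(F) → ⊕_v Br(F_v)` lands in the direct SUM: Cassels–Fröhlich VII §7.3
Prop. 7.3 / §9.6; Milne *ADT* I §4, proof of Lemma 4.8: a class of `H²(G_S, M)` maps to the restricted product),
usually passed over in one sentence; in the tree it was so far a HYPOTHESIS of every reciprocity statement
(`LocalInvariants.SumInvLocalizationEqZero`: "for every finite set `S` OUTSIDE WHICH the invariants vanish").

THE PROOF (assembly of tree theorems).
1. Kummer: `κ(y) ∈ H²(Γ_F, F̄ˣ) = Br(F)` (`cohomologyMap (kummerι F n) 2`).
2. `Br(F) = ⋃_E H²(Gal(E/F), Eˣ)` (`exists_unitsInfTwo_eq`, door-c6's layer-inflation limit, Serre X §4 Prop. 6):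
   `κ(y) = inf β` for a finite Galois layer `E ⊆ F̄`; §1 rewrites the embedded-layer inflation `unitsInfTwo F E` as the
   abstract-layer inflation `unitsAbsInfTwo F ↥E` used by the idèle dictionary (`unitsAbsInfTwo_coe_eq_unitsInfTwo`:
   transport along `embeddedEquiv`, `unitsInfTwo_unitsCohomologyIso_eq_of_eq`, `fieldRange_eq_embeddedField`).
3. Door-c5's idèle-side invariants `localInv E v (brauerToIdele β)` of the relative class are finitely supported
   (`IdeleCohomology.finite_support_localInv`: a class of `H²(G, J_E)` has finitely many non-zero semi-local components).
4. The dictionary `localInv E v (brauerToIdele β) = 0 ↔ inv_v (loc_v y) = 0` for THE canonical invariant map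
   `inv_v = LocalInvariants.canonical F n (Sum.inr v)` (`IdeleCohomology.localInv_brauerToIdele_eq_zero_iff`, from
   `IdeleBrauerLocalInvariantsDictionary` + Kummer naturality), and `inv_v` is injective (`canonical_isPerfect`).

COROLLARY (§3): Tate's reciprocity law `∑_v inv_v (loc_v y) = 0` for THE canonical family
(`sumInvLocalizationEqZero_canonical_of_numberField`, every number field) now holds in the unconditional form
**`exists_finset_sum_canonical_localization_eq_zero`**: for every `y` there IS a finite set of places `S` (containing
the infinite places) outside which `loc_v y = 0`, and `∑_{v ∈ S} inv_v (loc_v y) = 0`.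

Written for crux K4 `SignedControlAtTwo` (stmt-BirchSwinnertonDyer-20309, cell bsd-wall, lead tp2-p3 g6): it is brick
B1 "finite support" of the two roads to the stub `stub_realThreeOrderTwoBase` (`H³(F, ℤ/2) ↪ ⊕_{w real} H³(F_w, ℤ/2)`:
width seats w2 g7 `HBASE-ROAD-w2g7.md` B1, w3 g9 file B).  HONEST FRAMING: classical (Brauer–Hasse–Noether era)
bookkeeping; proves no case of BSD.

## References
* J. W. S. Cassels, A. Fröhlich (eds.), *Algebraic Number Theory* (1967), Ch. VII (J. Tate) §7.3 Prop. 7.3, §9.6,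
  §11.2. [CasselsFrohlichANT1967]
* J. S. Milne, *Arithmetic Duality Theorems* (2nd ed. 2006), Ch. I §4, Lemma 4.8 and its proof. [MilneADT2006]
* J.-P. Serre, *Local Fields*, GTM 67 (1979), Ch. X §4 Prop. 6 and Cor. [SerreLocalFields1979]
-/

noncomputable section

open NumberField IsDedekindDomain CategoryTheory groupCohomology Function Field
open Literature.NumberTheory.Automorphic

namespace Literature.NumberTheory.GaloisRepresentations

open DiscreteGaloisModule Literature.NumberTheory.GaloisCohomology

variable {F : Type} [Field F] [NumberField F]

/-! ## §1. The embedded-layer inflation is the abstract-layer inflation; every Brauer class is an `unitsAbsInfTwo` -/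

/-- **`unitsAbsInfTwo F ↥E = unitsInfTwo F E`** for a finite Galois layer `E ⊆ F̄` given as an intermediate field:
the transport to the embedded copy `embeddedField F ↥E` (which IS `E`, `UnitsLayer.fieldRange_eq_embeddedField`)
along `embeddedEquiv` does not change the inflated class (`UnitsLayer.unitsInfTwo_unitsCohomologyIso_eq_of_eq`).
[cite: SerreLocalFields1979, Ch. X §4 Prop. 6][cite: SerreGaloisCohomology1997, Ch. I §2.6] -/
theorem unitsAbsInfTwo_coe_eq_unitsInfTwo (E : IntermediateField F (AlgebraicClosure F)) [FiniteDimensional F E]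
    [IsGalois F E] (x : groupCohomology (Rep.ofAlgebraAutOnUnits F E) 2) :
    unitsAbsInfTwo F E x = unitsInfTwo F E x := by
  have hL : E = embeddedField F E :=
    E.fieldRange_val.symm.trans (UnitsLayer.fieldRange_eq_embeddedField (K := F) (L := E) E.val)
  rw [unitsAbsInfTwo_apply,
    UnitsLayer.unitsInfTwo_unitsCohomologyIso_eq_of_eq F hL (AlgEquiv.refl : E ≃ₐ[F] E) (embeddedEquiv F E) x,
    UnitsLayer.unitsCohomologyIso_self_hom]
  rfl

/-- **Every class of `Br(F) = H²(Γ_F, F̄ˣ)` is the abstract-layer inflation `unitsAbsInfTwo F E β` of a relative class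
`β ∈ H²(Gal(E/F), Eˣ)` for some finite Galois `E ⊆ F̄`** (`exists_unitsInfTwo_eq` + §1).
[cite: SerreLocalFields1979, Ch. X §4 Prop. 6 and Cor.] -/
theorem exists_unitsAbsInfTwo_eq (c : galoisCohomology (units F) 2) :
    ∃ (E : IntermediateField F (AlgebraicClosure F)) (_ : FiniteDimensional F E) (_ : IsGalois F E)
      (β : groupCohomology (Rep.ofAlgebraAutOnUnits F E) 2), unitsAbsInfTwo F E β = c := by
  obtain ⟨E, hfd, hgal, x, hx⟩ := exists_unitsInfTwo_eq F c
  exact ⟨E, hfd, hgal, x, (unitsAbsInfTwo_coe_eq_unitsInfTwo E x).trans hx⟩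

/-! ## §2. Finite support of the localisations of a class of `H²(Γ_F, μₙ)` -/

/-- **A class `y ∈ H²(Γ_F, μₙ)` is locally trivial at all but finitely many finite places**: the set of finite
places `v` with `loc_v y ≠ 0` is finite (Kummer + `Br(F) = ⋃ Br(E/F)` + finite support of the idèle-side invariants
of the relative class + the dictionary to THE canonical invariant maps, which are injective).
[cite: CasselsFrohlichANT1967, Ch. VII §7.3 Prop. 7.3, §9.6][cite: MilneADT2006, Ch. I §4, Lemma 4.8] -/
theorem finite_setOf_localization_mu_two_ne_zero (n : ℕ) [NeZero n] (y : galoisCohomology (mu F n) 2) :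
    {v : HeightOneSpectrum (𝓞 F) | galoisCohomology.localization (mu F n) (Sum.inr v) 2 y ≠ 0}.Finite := by
  obtain ⟨E, hfd, hgal, β, hβ⟩ := exists_unitsAbsInfTwo_eq (cohomologyMap (kummerι F n) 2 y)
  haveI := hfd
  haveI := hgal
  haveI : NumberField E := NumberField.of_module_finite F E
  refine (IdeleCohomology.finite_support_localInv (E := E) (IdeleCohomology.brauerToIdele F E β)).subset
    fun v hv => ?_
  rw [Function.mem_support]
  intro h0
  refine hv ?_
  have h1 : LocalInvariants.canonical F n (Sum.inr v)
      (galoisCohomology.localization (mu F n) (Sum.inr v) 2 y) = 0 :=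
    (IdeleCohomology.localInv_brauerToIdele_eq_zero_iff β y hβ.symm v).1 h0
  exact (injective_iff_map_eq_zero _).1 (LocalInvariants.canonical_isPerfect (K := F) (n := n) v).1.1 _ h1

/-- Finite-set form: there is a finite set of finite places outside which `loc_v y = 0`.
[cite: CasselsFrohlichANT1967, Ch. VII §7.3 Prop. 7.3][cite: MilneADT2006, Ch. I §4, Lemma 4.8] -/
theorem exists_finset_forall_localization_mu_two_eq_zero (n : ℕ) [NeZero n] (y : galoisCohomology (mu F n) 2) :
    ∃ S : Finset (HeightOneSpectrum (𝓞 F)), ∀ v ∉ S,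
      galoisCohomology.localization (mu F n) (Sum.inr v) 2 y = 0 := by
  refine ⟨(finite_setOf_localization_mu_two_ne_zero n y).toFinset, fun v hv => ?_⟩
  by_contra h
  exact hv ((Set.Finite.mem_toFinset _).2 h)

/-- All places: the set of places `v` of `F` (finite or infinite) with `loc_v y ≠ 0` is finite (there are finitely
many infinite places). [cite: CasselsFrohlichANT1967, Ch. VII §7.3 Prop. 7.3][cite: MilneADT2006, Ch. I §4, Lemma 4.8] -/
theorem finite_setOf_localization_mu_two_ne_zero_place (n : ℕ) [NeZero n] (y : galoisCohomology (mu F n) 2) :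
    {v : Place F | galoisCohomology.localization (mu F n) v 2 y ≠ 0}.Finite := by
  refine ((Set.finite_range (Sum.inl : InfinitePlace F → Place F)).union
    ((finite_setOf_localization_mu_two_ne_zero n y).image Sum.inr)).subset ?_
  rintro (w | v) hv
  · exact Or.inl ⟨w, rfl⟩
  · exact Or.inr ⟨v, hv, rfl⟩

/-- Finite-set form over all places, the infinite places included in the set.
[cite: CasselsFrohlichANT1967, Ch. VII §7.3 Prop. 7.3][cite: MilneADT2006, Ch. I §4, Lemma 4.8] -/
theorem exists_finset_place_forall_localization_mu_two_eq_zero (n : ℕ) [NeZero n]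
    (y : galoisCohomology (mu F n) 2) :
    ∃ S : Finset (Place F), (∀ w : InfinitePlace F, (Sum.inl w : Place F) ∈ S) ∧
      ∀ v ∉ S, galoisCohomology.localization (mu F n) v 2 y = 0 := by
  classical
  refine ⟨(finite_setOf_localization_mu_two_ne_zero_place n y).toFinset ∪
      Finset.univ.map ⟨Sum.inl, Sum.inl_injective⟩, fun w => ?_, fun v hv => ?_⟩
  · exact Finset.mem_union_right _ (Finset.mem_map.2 ⟨w, Finset.mem_univ _, rfl⟩)
  · by_contra h
    exact hv (Finset.mem_union_left _ ((Set.Finite.mem_toFinset _).2 h))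

/-! ## §3. Tate's reciprocity law `∑_v inv_v = 0` on `H²(Γ_F, μₙ)`, unconditional form -/

/-- **`∑_v inv_v (loc_v y) = 0` for every `y ∈ H²(Γ_F, μₙ)` and THE canonical invariant maps** — with the finite
set of summation PRODUCED, not assumed: there is a finite set of places `S ⊇ {v ∣ ∞}` with `loc_v y = 0` off `S`
and `∑_{v ∈ S} inv_v (loc_v y) = 0` (`sumInvLocalizationEqZero_canonical_of_numberField` + §2).
[cite: CasselsFrohlichANT1967, Ch. VII §9.6, §11.2][cite: MilneADT2006, Ch. I, Thm. 4.10 (b)] -/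
theorem exists_finset_sum_canonical_localization_eq_zero (n : ℕ) [NeZero n] (y : galoisCohomology (mu F n) 2) :
    ∃ S : Finset (Place F), (∀ w : InfinitePlace F, (Sum.inl w : Place F) ∈ S) ∧
      (∀ v ∉ S, galoisCohomology.localization (mu F n) v 2 y = 0) ∧
      ∑ v ∈ S, LocalInvariants.canonical F n v (galoisCohomology.localization (mu F n) v 2 y) = 0 := by
  obtain ⟨S, hinf, hS⟩ := exists_finset_place_forall_localization_mu_two_eq_zero n y
  exact ⟨S, hinf, hS, sumInvLocalizationEqZero_canonical_of_numberField F n y S fun v hv => by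
    rw [hS v hv, map_zero]⟩

/-- The same over any finite set of places containing the support: if `loc_v y = 0` off `S` then
`∑_{v ∈ S} inv_v (loc_v y) = 0` (restatement of `sumInvLocalizationEqZero_canonical_of_numberField` with the
vanishing of the CLASSES, not only of their invariants, as hypothesis). [cite: CasselsFrohlichANT1967, Ch. VII §11.2] -/
theorem sum_canonical_localization_eq_zero_of_forall_not_mem (n : ℕ) [NeZero n] (y : galoisCohomology (mu F n) 2)
    (S : Finset (Place F)) (hS : ∀ v ∉ S, galoisCohomology.localization (mu F n) v 2 y = 0) :
    ∑ v ∈ S, LocalInvariants.canonical F n v (galoisCohomology.localization (mu F n) v 2 y) = 0 :=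
  sumInvLocalizationEqZero_canonical_of_numberField F n y S fun v hv => by rw [hS v hv, map_zero]

end Literature.NumberTheory.GaloisRepresentations

end
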